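import Summits.QuantumFields.YangMills.Theorems.BalabanUVNodesN16ApproximateSchemeTransferSub
import HarnessLib

/-!
# YM-DAG node N16 (NE3), the located averaging pin (42) ↔ (0.4) — part 28: THE APPROXIMATE TRANSFER PRINCIPLE (II) — N16's ACTION-RATE END `T4EtaRateMin.ActionRate`
# ∕ `NE3Shape` under an `O(θ^k)` perturbation of the action entries, and its SCHEME TRANSFER from (43) to any scheme δ-close up to gauge with geometric right-inverse moduli

Cell `pub-ymgap`, width seat `pub-ymgap-dag-n16-w3` (director-ym №197 ∕ HUMAN RULING D-0149), generation 9; part 28 of the W1b lineage, the END-reading half of part 27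
(`…N16ApproximateSchemeTransfer`: `CfgNear`, `RightInverseModulus` (H2); part 27′ `…Sub`: (H1) `ApproxSchemeGaugeEquivIn Γ` with the gauge group a PARAMETER `Γ ≤ U(N)` —
`SU(N)` for the (0.4) side, part 23's (d1) — and `abs_sInf_admissibleS_sub_minAct_le`).
`--supports stmt-QuantumFields-27366 --as helper` (K3⁸, KEY MAP v2; count-neutral).  `bears_on: R4∕N16`.

THE POINT.  N16's END (A) is not a single number but the RATE statement `T4EtaRateMin.ActionRate (minActReadings d 𝒞 L N dom loc) C θ` —
`|A_{k+1}(V) − A_k(V)| ≤ C·θ^k·N^d` on `dom` (pub-balaban's `MinimalActionRate.actionRate_of_sandwichData` conclusion shape, [King1986] (3.71) template) — about the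
(43)-constrained minimal actions `A_k(V) = minAct`.  Part 27 moves each `A_k(V)` by at most the right-inverse modulus `ω_k` under a scheme change δ_k-close up to gauge;
this file reads that at the level of the rate:
 * §1 (abstract `T4EtaRateMin.Readings`) ★★ `actionRate_of_act_near`: two carriers with the same `dom` ∕ `vol` and `|act′ k V − act k V| ≤ C′θ^k·vol` on `dom`
   (`0 ≤ θ ≤ 1`, `0 ≤ C′`) have `ActionRate R C θ → ActionRate R′ (C + 2C′) θ`; `ne3Shape_of_act_near` (same `loc`: the `LocalRate` half is shared verbatim).
   ★★★ `actionRate_of_sub_cauchy` — THE CORRECT SHAPE FOR TWO GENUINELY DIFFERENT CONSTRAINTS: only the INCREMENTS of the discrepancy `Δ_k = act′ k − act k` must decay,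
   `|Δ_{k+1} − Δ_k| ≤ C′θ^k·vol` ⇒ `ActionRate R C θ → ActionRate R′ (C + C′) θ`; `tendsto_sub_zero_of_act_near` — the `_of_act_near` road forces `Δ_k → 0` (equal limiting
   minimal actions), so it — and §2∕§3 below, built on right-inverse moduli `ω_k ≤ C′θ^k·vol` — covers ASYMPTOTICALLY EQUIVALENT schemes only.  HONEST LOCATED POINT (self-refereed):
   (42) and (0.4) are different averaging functionals AT UNIT BLOCK SCALE (corner vs centre base points, tree vs symmetrised contours; parts 1–11), so their constrained minimal
   actions have different limits `A_∞(V) ≠ A′_∞(V)` in general and §2∕§3 are VACUOUS-IN-REGIME for that pair; the (42)→(0.4) pin for END (A) is the CAUCHY DISCREPANCY input of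
   `actionRate_of_sub_cauchy`, for which no estimate is typed anywhere.
 * §2 ★★★ `actionRate_schemeReadings_of_actionRate_minActReadings`: on a class with a level-action lower bound, invariant under `Γ`-valued `(N·L^k)`-periodic gauges, a scheme
   `s` with (H1) `ApproxSchemeGaugeEquivIn d Γ (step42 L) s L N k (𝒞 k) (δ k)` at EVERY depth and (H2) `RightInverseModulus` for `s` AND for (43) on the data `dom` with moduli
   `ω k ≤ C′θ^k·N^d` ((43)-admissible data) inherits N16's END (A): `ActionRate (minActReadings d 𝒞 L N dom loc) C θ → ActionRate ⟨dom, inf A^{(k)}(admissibleS s 𝒞 k ·), loc, N^d⟩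
   (C + 2C′) θ` — the displayed `s`-readings carrier (a structure literal, no new definition, as in part 17 `minActReadings_eq_cstepReadings`); `ne3Shape_…` likewise.
 * §3 on the small-field class `sfClass d L N ε` of N16's reading (`U(N)`-valued, invariant under every `Γ ≤ U(N)` by pub-balaban's `mem_sfClass_gaugeAct`) only (H1), (H2) and
   admissibility remain displayed (`actionRate_schemeReadings_sfClass`, `ne3Shape_schemeReadings_sfClass`); at N16's objects of record (`d = 4`, `𝔸 = M_N(ℂ)`,
   `N = ne3NperOfRecord₁₁ F 0 0 = 2L^m`, `s := step04 F N`) this is THE (42)→(0.4) PIN FOR END (A) modulo the two named analytic inputs with GEOMETRIC moduli.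
READING (honest; for the planners, D-0014, nothing re-cut or filed).  §2∕§3 say: schemes that are ASYMPTOTICALLY EQUIVALENT to (43) ((H1)+(H2) with `ω_k = O(θ^k·N^d)`,
`θ = L^{−2}` N16's rate of record) inherit N16's END (A).  For the (0.4) scheme OF RECORD this is NOT the mechanism (different unit-scale functionals, different limits); there the
END pin is §1's `actionRate_of_sub_cauchy` with the Cauchy discrepancy of the two minimal-action sequences as the ONE located input — a locality statement about constrained
minimisers of the same depth as END (A) itself, absent from print and tree.

HONEST FRAMING.  [folklore] bookkeeping BY NAME over part 27 and pub-balaban's `T4EtaRateMin.ActionRate ∕ NE3Shape`, `MinimalActionRate.minActReadings ∕ sfClass`,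
`NE3ResidualSliceRep.mem_sfClass_gaugeAct`; 0 `def`, 0 `sorry`, no `instance`, no `notation`; NO estimate proved; nothing of [Balaban1985Variational] ∕ [Balaban1987RG1] ∕
[King1986] asserted; K3⁸ stubs `stub_rates13HV` ∕ `stub_expansion13HV` NOT touched; N16 ∕ NE3 NOT discharged; count-neutral (typed 28∕28 · discharged 5∕27 work-bound,
A 5∕28 — unmoved).  One finite four-torus programme at fixed `ε` — the Yang–Mills mass gap (Clay) is NOT proved by any of this; R4 closes the conditional finite-𝕋⁴ rung
`BalabanLadder.UV` only; nothing continuum ∕ ℝ⁴ ∕ OS.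
-/


set_option autoImplicit false

open scoped BigOperators Matrix Matrix.Norms.L2Operator
open NormedSpace

namespace Summit.QuantumFields.YangMills.BalabanUVNodes.N16ApproximateSchemeTransferEnd

open Literature.MathematicalPhysics.QuantumFieldTheory.Balaban1983to89
open Literature.MathematicalPhysics.QuantumFieldTheory.Balaban1983to89.T4Continuum (T4Family)
open B7Prop1Explicit B7Prop2Explicit
open Summit.QuantumFields.BalabanUV.T4Continuum
open MinimalActionLevels (levelAction levelAction_nonneg)
open MinimalActionSandwich (admissible minAct IsMinimiser)
open MinimalActionRate (sfClass minActReadings)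
open NE3EnergyShapes (IsUnitarySite IsPeriodicSite)
open T4AveragingDeficitWall (IsUnitaryCfg)
open NE3ResidualSliceRep (mem_sfClass_gaugeAct)
open AveragingDeficitKDatum (gaugeAct_inv_gaugeAct)
open NE7EtaMinimiserGaugeCovariance (levelAction_gaugeAct isUnitarySite_inv isPeriodicSite_inv)
open Node00 (MatA ne3NperOfRecord₁₁ ne3DomOfRecord₁₁)
open Summit.QuantumFields.YangMills.BalabanUVNodes.N16AveragingPin
  (avgIterS step42 avgIterS_step42 admissibleS mem_admissibleS_iff admissibleS_step42 IsMinimiserS)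
open Summit.QuantumFields.YangMills.BalabanUVNodes.N16AveragingTransferOfGaugeDefect (isUnitarySite_blockLift isPeriodicSite_blockLift)
open Summit.QuantumFields.YangMills.BalabanUVNodes.N16CentreConventionTransfer (SchemeGaugeEquiv gaugeAct_gaugeAct)
open Summit.QuantumFields.YangMills.BalabanUVNodes.N16ApproximateSchemeTransfer (CfgNear ApproxSchemeGaugeEquiv RightInverseModulus bddBelow_levelAction_image_of_isUnitaryCfg)
open Summit.QuantumFields.YangMills.BalabanUVNodes.N16ApproximateSchemeTransferSub (ApproxSchemeGaugeEquivIn abs_sInf_admissibleS_sub_minAct_le)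

noncomputable section

variable {d : ℕ} {n : Type*} [Fintype n] [DecidableEq n]

/-! ## §1–§2 THE END READING: `ActionRate` ∕ `NE3Shape` under an `O(θ^k)` perturbation of the action entries, and the scheme transfer of N16's END (A) -/

section Readings

variable {ι X : Type*}

/-- **★★ `ActionRate` UNDER AN `O(θ^k·vol)` PERTURBATION OF THE ACTION ENTRIES** (abstract `T4EtaRateMin.Readings`): if `R′` has the data and volume of `R` and
`|R′.act k V − R.act k V| ≤ C′θ^k·vol` on `dom` for every `k` (`0 ≤ θ ≤ 1`, `0 ≤ C′`), then `ActionRate R C θ → ActionRate R′ (C + 2C′) θ`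
(`|a′_{k+1} − a′_k| ≤ C′θ^{k+1}vol + Cθ^k vol + C′θ^k vol`). [folklore] -/
theorem actionRate_of_act_near {R R' : T4EtaRateMin.Readings ι X} {C C' θ : ℝ} (hdom : R'.dom = R.dom) (hvol : R'.vol = R.vol)
    (hθ0 : 0 ≤ θ) (hθ1 : θ ≤ 1) (hC' : 0 ≤ C')
    (hnear : ∀ (k : ℕ), ∀ V ∈ R.dom, |R'.act k V - R.act k V| ≤ C' * θ ^ k * R.vol)
    (h : T4EtaRateMin.ActionRate R C θ) : T4EtaRateMin.ActionRate R' (C + 2 * C') θ := by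
  intro k V hV
  rw [hdom] at hV
  rw [hvol]
  have h0 := h k V hV
  have h1 := hnear k V hV
  have h2 := hnear (k + 1) V hV
  have hθk : θ ^ (k + 1) ≤ θ ^ k := pow_le_pow_of_le_one hθ0 hθ1 (Nat.le_succ k)
  have hcv : 0 ≤ C' * R.vol := mul_nonneg hC' R.vol_nonneg
  have h2' : |R'.act (k + 1) V - R.act (k + 1) V| ≤ C' * θ ^ k * R.vol := by
    refine h2.trans ?_
    have : C' * θ ^ (k + 1) * R.vol = (C' * R.vol) * θ ^ (k + 1) := by ring
    rw [this, show C' * θ ^ k * R.vol = (C' * R.vol) * θ ^ k by ring]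
    exact mul_le_mul_of_nonneg_left hθk hcv
  calc |R'.act (k + 1) V - R'.act k V|
      ≤ |R'.act (k + 1) V - R.act (k + 1) V| + |R.act (k + 1) V - R'.act k V| := abs_sub_le _ _ _
    _ ≤ |R'.act (k + 1) V - R.act (k + 1) V| + (|R.act (k + 1) V - R.act k V| + |R.act k V - R'.act k V|) :=
        by linarith [abs_sub_le (R.act (k + 1) V) (R.act k V) (R'.act k V)]
    _ ≤ C' * θ ^ k * R.vol + (C * θ ^ k * R.vol + C' * θ ^ k * R.vol) := by
        refine add_le_add h2' (add_le_add h0 ?_)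
        rw [abs_sub_comm]; exact h1
    _ = (C + 2 * C') * θ ^ k * R.vol := by ring

/-- **`NE3Shape` UNDER THE SAME PERTURBATION** (the local readings `loc` untouched): `NE3Shape R C θ → NE3Shape R′ (C + 2C′) θ`. [folklore] -/
theorem ne3Shape_of_act_near {R R' : T4EtaRateMin.Readings ι X} {C C' θ : ℝ} (hdom : R'.dom = R.dom) (hvol : R'.vol = R.vol) (hloc : R'.loc = R.loc)
    (hC' : 0 ≤ C') (hnear : ∀ (k : ℕ), ∀ V ∈ R.dom, |R'.act k V - R.act k V| ≤ C' * θ ^ k * R.vol)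
    (h : T4EtaRateMin.NE3Shape R C θ) : T4EtaRateMin.NE3Shape R' (C + 2 * C') θ where
  rate_nonneg := h.rate_nonneg
  rate_lt_one := h.rate_lt_one
  action := actionRate_of_act_near hdom hvol h.rate_nonneg h.rate_lt_one.le hC' hnear h.action
  pointwise k V hV x := by
    rw [hdom] at hV
    rw [hloc]
    refine (h.pointwise k V hV x).trans ?_
    have : 0 ≤ 2 * C' * θ ^ k := mul_nonneg (by linarith) (pow_nonneg h.rate_nonneg k)
    nlinarith

/-- **★★★ `ActionRate` UNDER A GEOMETRICALLY CAUCHY DISCREPANCY** — THE CORRECT SHAPE FOR TWO GENUINELY DIFFERENT CONSTRAINTS: if `R′` has the data and volume of `R` and the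
DISCREPANCY `Δ_k(V) := R′.act k V − R.act k V` is geometrically Cauchy, `|Δ_{k+1}(V) − Δ_k(V)| ≤ C′θ^k·vol` on `dom`, then `ActionRate R C θ → ActionRate R′ (C + C′) θ`.  The
discrepancy need NOT tend to `0` (two different averaging constraints have different limiting minimal actions `A_∞(V) ≠ A′_∞(V)` in general — the (42) vs (0.4) situation);
only its INCREMENTS must decay.  This is the located shape of the END-number pin; `actionRate_of_act_near` is its special case `Δ_k → 0`. [folklore] -/
theorem actionRate_of_sub_cauchy {R R' : T4EtaRateMin.Readings ι X} {C C' θ : ℝ} (hdom : R'.dom = R.dom) (hvol : R'.vol = R.vol)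
    (hΔ : ∀ (k : ℕ), ∀ V ∈ R.dom, |(R'.act (k + 1) V - R.act (k + 1) V) - (R'.act k V - R.act k V)| ≤ C' * θ ^ k * R.vol)
    (h : T4EtaRateMin.ActionRate R C θ) : T4EtaRateMin.ActionRate R' (C + C') θ := by
  intro k V hV
  rw [hdom] at hV
  rw [hvol]
  have h0 := h k V hV
  have h1 := hΔ k V hV
  have e : R'.act (k + 1) V - R'.act k V = (R.act (k + 1) V - R.act k V) + ((R'.act (k + 1) V - R.act (k + 1) V) - (R'.act k V - R.act k V)) := by ring
  rw [e]
  refine (abs_add_le _ _).trans ?_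
  calc |R.act (k + 1) V - R.act k V| + |R'.act (k + 1) V - R.act (k + 1) V - (R'.act k V - R.act k V)|
      ≤ C * θ ^ k * R.vol + C' * θ ^ k * R.vol := add_le_add h0 h1
    _ = (C + C') * θ ^ k * R.vol := by ring

/-- **THE `_of_act_near` ROAD FORCES EQUAL LIMITS** (vacuity witness): under its hypothesis `|R′.act k V − R.act k V| ≤ C′θ^k·vol` with `0 ≤ θ < 1` the discrepancy tends to `0`.
So that road (and every theorem below built on right-inverse moduli `ω_k ≤ C′θ^k·vol`) applies ONLY to ASYMPTOTICALLY EQUIVALENT constraints — NOT to (42) vs (0.4), whose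
limiting minimal actions differ in general (different continuum averaging functionals on the unit block); for those the input is `actionRate_of_sub_cauchy`'s Cauchy
discrepancy, a LOCATED quantity nobody has typed an estimate for. [folklore] -/
theorem tendsto_sub_zero_of_act_near {R R' : T4EtaRateMin.Readings ι X} {C' θ : ℝ} (hθ0 : 0 ≤ θ) (hθ1 : θ < 1)
    (hnear : ∀ (k : ℕ), ∀ V ∈ R.dom, |R'.act k V - R.act k V| ≤ C' * θ ^ k * R.vol) {V : ι} (hV : V ∈ R.dom) :
    Filter.Tendsto (fun k => R'.act k V - R.act k V) Filter.atTop (nhds 0) := by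
  have hg : Filter.Tendsto (fun k : ℕ => C' * θ ^ k * R.vol) Filter.atTop (nhds 0) := by
    have := (tendsto_pow_atTop_nhds_zero_of_lt_one hθ0 hθ1).const_mul C'
    simpa using this.mul_const R.vol
  exact squeeze_zero_norm (fun k => by rw [Real.norm_eq_abs]; exact hnear k V hV) hg

variable {Γ : Subgroup (Matrix n n ℂ)ˣ} {s : ℕ → (Site d → Fin d → (Matrix n n ℂ)ˣ) → (Site d → Fin d → (Matrix n n ℂ)ˣ)}
  {𝒞 : ℕ → Set (Site d → Fin d → (Matrix n n ℂ)ˣ)} {L N : ℕ} {dom : Set (Site d → Fin d → (Matrix n n ℂ)ˣ)}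

/-- **★★★ THE SCHEME TRANSFER OF N16's ACTION-RATE END**.  On a class `𝒞` with a level-action lower bound at every depth and invariant under unitary `(N·L^k)`-periodic gauges,
let `s` be a scheme with (H1) `ApproxSchemeGaugeEquivIn d Γ (step42 L) s L N k (𝒞 k) (δ k)` at every depth (gauges in `Γ ≤ U(N)`) and (H2) right-inverse moduli `ω k ≤ C′·θ^k·N^d` for `s` AND for (43)
on the data `dom`, all of which are (43)-admissible at every depth.  Then N16's END (A) for the (43)-constrained minimal actions,
`ActionRate (minActReadings d 𝒞 L N dom loc) C θ` (`0 ≤ θ ≤ 1`), gives the same END with constant `C + 2C′` for the displayed readings carrier whose action entry is the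
`s`-CONSTRAINED minimal action `inf A^{(k)}(admissibleS s 𝒞 k V)` (same `dom`, `loc`, `vol = N^d`).  The (42)→(0.4) pin for END (A) is this with `s := step04 F N` —
modulo (H1)+(H2), neither proved here. [folklore] -/
theorem actionRate_schemeReadings_of_actionRate_minActReadings (hΓ : Γ ≤ unitaryUnits (Matrix n n ℂ)) (hL : 1 ≤ L)
    (hB : ∀ k, BddBelow (levelAction d L N k '' 𝒞 k))
    (hC : ∀ (k : ℕ) (u : Site d → (Matrix n n ℂ)ˣ) (U : Site d → Fin d → (Matrix n n ℂ)ˣ), (∀ x, u x ∈ Γ) →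
      IsPeriodicSite u ((N * L ^ k : ℕ) : ℤ) → U ∈ 𝒞 k → gaugeAct u U ∈ 𝒞 k)
    {δ ω : ℕ → ℝ} (hE : ∀ k, ApproxSchemeGaugeEquivIn d Γ (fun _ => step42 L) s L N k (𝒞 k) (δ k))
    (hR43 : ∀ k, RightInverseModulus d (fun _ => step42 L) 𝒞 L N k dom (δ k) (ω k))
    (hRs : ∀ k, RightInverseModulus d s 𝒞 L N k dom (δ k) (ω k))
    (hadm : ∀ k, ∀ V ∈ dom, (admissible 𝒞 L k V).Nonempty)
    {C C' θ : ℝ} (hθ0 : 0 ≤ θ) (hθ1 : θ ≤ 1) (hC' : 0 ≤ C') (hω : ∀ k, ω k ≤ C' * θ ^ k * (N : ℝ) ^ d)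
    {X : Type*} (loc : ℕ → (Site d → Fin d → (Matrix n n ℂ)ˣ) → X → ℝ)
    (h : T4EtaRateMin.ActionRate (minActReadings d 𝒞 L N dom loc) C θ) :
    T4EtaRateMin.ActionRate
      ({ dom := dom
         act := fun k V => sInf (levelAction d L N k '' admissibleS s 𝒞 k V)
         loc := loc
         vol := (N : ℝ) ^ d
         vol_nonneg := by positivity } : T4EtaRateMin.Readings (Site d → Fin d → (Matrix n n ℂ)ˣ) X) (C + 2 * C') θ := by
  refine actionRate_of_act_near (R := minActReadings d 𝒞 L N dom loc) rfl rfl hθ0 hθ1 hC' ?_ h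
  intro k V hV
  exact (abs_sInf_admissibleS_sub_minAct_le hΓ hL (hC k) (hE k) (hR43 k) (hRs k) hV (hadm k V hV) (hB k)).trans (hω k)

/-- **THE SAME FOR THE FULL SHAPE `NE3Shape`** (action half transferred, local half shared verbatim through the common `loc`). [folklore] -/
theorem ne3Shape_schemeReadings_of_ne3Shape_minActReadings (hΓ : Γ ≤ unitaryUnits (Matrix n n ℂ)) (hL : 1 ≤ L)
    (hB : ∀ k, BddBelow (levelAction d L N k '' 𝒞 k))
    (hC : ∀ (k : ℕ) (u : Site d → (Matrix n n ℂ)ˣ) (U : Site d → Fin d → (Matrix n n ℂ)ˣ), (∀ x, u x ∈ Γ) →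
      IsPeriodicSite u ((N * L ^ k : ℕ) : ℤ) → U ∈ 𝒞 k → gaugeAct u U ∈ 𝒞 k)
    {δ ω : ℕ → ℝ} (hE : ∀ k, ApproxSchemeGaugeEquivIn d Γ (fun _ => step42 L) s L N k (𝒞 k) (δ k))
    (hR43 : ∀ k, RightInverseModulus d (fun _ => step42 L) 𝒞 L N k dom (δ k) (ω k))
    (hRs : ∀ k, RightInverseModulus d s 𝒞 L N k dom (δ k) (ω k))
    (hadm : ∀ k, ∀ V ∈ dom, (admissible 𝒞 L k V).Nonempty)
    {C C' θ : ℝ} (hC' : 0 ≤ C') (hω : ∀ k, ω k ≤ C' * θ ^ k * (N : ℝ) ^ d)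
    {X : Type*} (loc : ℕ → (Site d → Fin d → (Matrix n n ℂ)ˣ) → X → ℝ)
    (h : T4EtaRateMin.NE3Shape (minActReadings d 𝒞 L N dom loc) C θ) :
    T4EtaRateMin.NE3Shape
      ({ dom := dom
         act := fun k V => sInf (levelAction d L N k '' admissibleS s 𝒞 k V)
         loc := loc
         vol := (N : ℝ) ^ d
         vol_nonneg := by positivity } : T4EtaRateMin.Readings (Site d → Fin d → (Matrix n n ℂ)ˣ) X) (C + 2 * C') θ := by
  refine ne3Shape_of_act_near (R := minActReadings d 𝒞 L N dom loc) rfl rfl rfl hC' ?_ h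
  intro k V hV
  exact (abs_sInf_admissibleS_sub_minAct_le hΓ hL (hC k) (hE k) (hR43 k) (hRs k) hV (hadm k V hV) (hB k)).trans (hω k)

end Readings

/-! ## §3 At N16's objects: the small-field class is `U(N)`-valued and gauge invariant, so only (H1), (H2) and admissibility remain displayed -/

section Record

variable [Nonempty n] {Γ : Subgroup (Matrix n n ℂ)ˣ} {s : ℕ → (Site d → Fin d → (Matrix n n ℂ)ˣ) → (Site d → Fin d → (Matrix n n ℂ)ˣ)} {L N : ℕ} {ε : ℝ}
  {dom : Set (Site d → Fin d → (Matrix n n ℂ)ˣ)}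

/-- On the small-field class `sfClass d L N ε` the level action is bounded below at every depth (its members are `U(N)`-valued). [folklore] -/
theorem bddBelow_levelAction_image_sfClass (hL : 1 ≤ L) (k : ℕ) :
    BddBelow (levelAction d L N k '' (sfClass d L N ε k : Set (Site d → Fin d → (Matrix n n ℂ)ˣ))) :=
  bddBelow_levelAction_image_of_isUnitaryCfg hL fun _ hU => hU.1

/-- **★★ N16's END (A) ON THE SMALL-FIELD CLASS, SCHEME-TRANSFERRED**: for the class `sfClass d L N ε` of N16's reading (gauge invariant: pub-balaban's `mem_sfClass_gaugeAct`;
`U(N)`-valued), a scheme `s` with (H1) against (43) at every depth (defects `δ k`) and (H2) for `s` and for (43) with moduli `ω k ≤ C′θ^k·N^d` on (43)-admissible data `dom`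
inherits the ACTION-RATE END of the (43)-constrained minimal actions with constant `C + 2C′`: `ActionRate (minActReadings d (sfClass d L N ε) L N dom loc) C θ →
ActionRate ⟨dom, inf A^{(k)}(admissibleS s (sfClass …) k ·), loc, N^d⟩ (C + 2C′) θ`.  At N16's objects of record (`d = 4`, `𝔸 = M_N(ℂ)`, `N = ne3NperOfRecord₁₁ F 0 0 = 2L^m`,
`s := step04 F N`) this is THE (42)→(0.4) PIN FOR END (A) modulo the two named analytic inputs. [folklore] -/
theorem actionRate_schemeReadings_sfClass (hΓ : Γ ≤ unitaryUnits (Matrix n n ℂ)) (hL : 1 ≤ L)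
    {δ ω : ℕ → ℝ} (hE : ∀ k, ApproxSchemeGaugeEquivIn d Γ (fun _ => step42 L) s L N k (sfClass d L N ε k) (δ k))
    (hR43 : ∀ k, RightInverseModulus d (fun _ => step42 L) (sfClass d L N ε) L N k dom (δ k) (ω k))
    (hRs : ∀ k, RightInverseModulus d s (sfClass d L N ε) L N k dom (δ k) (ω k))
    (hadm : ∀ k, ∀ V ∈ dom, (admissible (sfClass d L N ε) L k V).Nonempty)
    {C C' θ : ℝ} (hθ0 : 0 ≤ θ) (hθ1 : θ ≤ 1) (hC' : 0 ≤ C') (hω : ∀ k, ω k ≤ C' * θ ^ k * (N : ℝ) ^ d)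
    {X : Type*} (loc : ℕ → (Site d → Fin d → (Matrix n n ℂ)ˣ) → X → ℝ)
    (h : T4EtaRateMin.ActionRate (minActReadings d (sfClass d L N ε) L N dom loc) C θ) :
    T4EtaRateMin.ActionRate
      ({ dom := dom
         act := fun k V => sInf (levelAction d L N k '' admissibleS s (sfClass d L N ε) k V)
         loc := loc
         vol := (N : ℝ) ^ d
         vol_nonneg := by positivity } : T4EtaRateMin.Readings (Site d → Fin d → (Matrix n n ℂ)ˣ) X) (C + 2 * C') θ :=
  actionRate_schemeReadings_of_actionRate_minActReadings (𝒞 := sfClass d L N ε) hΓ hL (bddBelow_levelAction_image_sfClass hL)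
    (fun _ _ _ hu huP hU => mem_sfClass_gaugeAct (fun x => hΓ (hu x)) huP hU) hE hR43 hRs hadm hθ0 hθ1 hC' hω loc h

/-- **… AND THE FULL `NE3Shape`** on the small-field class. [folklore] -/
theorem ne3Shape_schemeReadings_sfClass (hΓ : Γ ≤ unitaryUnits (Matrix n n ℂ)) (hL : 1 ≤ L)
    {δ ω : ℕ → ℝ} (hE : ∀ k, ApproxSchemeGaugeEquivIn d Γ (fun _ => step42 L) s L N k (sfClass d L N ε k) (δ k))
    (hR43 : ∀ k, RightInverseModulus d (fun _ => step42 L) (sfClass d L N ε) L N k dom (δ k) (ω k))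
    (hRs : ∀ k, RightInverseModulus d s (sfClass d L N ε) L N k dom (δ k) (ω k))
    (hadm : ∀ k, ∀ V ∈ dom, (admissible (sfClass d L N ε) L k V).Nonempty)
    {C C' θ : ℝ} (hC' : 0 ≤ C') (hω : ∀ k, ω k ≤ C' * θ ^ k * (N : ℝ) ^ d)
    {X : Type*} (loc : ℕ → (Site d → Fin d → (Matrix n n ℂ)ˣ) → X → ℝ)
    (h : T4EtaRateMin.NE3Shape (minActReadings d (sfClass d L N ε) L N dom loc) C θ) :
    T4EtaRateMin.NE3Shape
      ({ dom := dom
         act := fun k V => sInf (levelAction d L N k '' admissibleS s (sfClass d L N ε) k V)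
         loc := loc
         vol := (N : ℝ) ^ d
         vol_nonneg := by positivity } : T4EtaRateMin.Readings (Site d → Fin d → (Matrix n n ℂ)ˣ) X) (C + 2 * C') θ :=
  ne3Shape_schemeReadings_of_ne3Shape_minActReadings (𝒞 := sfClass d L N ε) hΓ hL (bddBelow_levelAction_image_sfClass hL)
    (fun _ _ _ hu huP hU => mem_sfClass_gaugeAct (fun x => hΓ (hu x)) huP hU) hE hR43 hRs hadm hC' hω loc h

end Record

end

end Summit.QuantumFields.YangMills.BalabanUVNodes.N16ApproximateSchemeTransferEnd
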